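import Literature.GroupTheory.CombinatorialGroupTheory.FreeGroupConjugacySeparable
import Mathlib.Topology.Algebra.Category.ProfiniteGrp.Completion
import HarnessLib

/-!
# Conjugacy separability of free groups: profinite-completion form

Topic `Literature/GroupTheory/CombinatorialGroupTheory`; theorems only.  The form in which
conjugacy separability of free groups (Stebe 1970, Thm. 1; Lyndon–Schupp, *Combinatorial Group
Theory*, Ch. I Prop. 4.8 — `FreeGroup.exists_normal_finiteIndex_not_isConj`) is quoted by
Mochizuki, IUTchI §2, proof of Thm. 2.6: two elements of a free group `F` whose images under the
canonical map `η : F → F̂` to the profinite completion (Mathlib's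
`ProfiniteGrp.ProfiniteCompletion.completion`, a projective limit of the finite quotients `F ⧸ K`)
are conjugate in `F̂` are already conjugate in `F` — project a conjugator `γ ∈ F̂` to each finite
quotient `F ⧸ K`.

## References

* P. F. Stebe, *A residual property of certain groups*, Proc. Amer. Math. Soc. 26 (1970) 37–42.
* R. C. Lyndon, P. E. Schupp, *Combinatorial Group Theory* (1977/2001), Ch. I, Prop. 4.8 and the
  remark following it (*"closely related to the concept of conjugacy separability"*).
  [LyndonSchupp2001]
-/

namespace Literature.GroupTheory.CombinatorialGroupTheory

open CategoryTheory ProfiniteGrp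

universe u

/-- **Free groups are conjugacy separable, profinite form**: if `η(u)` and `η(v)` are conjugate in
the profinite completion `F̂` of the free group `F = F(ι)` (`η = ProfiniteCompletion.etaFn`), then
`u` and `v` are conjugate in `F`.  (A conjugator `γ ∈ F̂ = lim F ⧸ K` projects to a conjugator in
every finite quotient `F ⧸ K`; conclude by `FreeGroup.isConj_of_forall_normal_finiteIndex`.)
[cite: LyndonSchupp2001, Ch. I Prop. 4.8] -/
theorem _root_.FreeGroup.isConj_of_isConj_profiniteCompletion {ι : Type u} {u v : FreeGroup ι}
    (h : IsConj (ProfiniteCompletion.etaFn (GrpCat.of (FreeGroup ι)) u)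
      (ProfiniteCompletion.etaFn (GrpCat.of (FreeGroup ι)) v)) : IsConj u v := by
  apply FreeGroup.isConj_of_forall_normal_finiteIndex
  intro K _ _
  obtain ⟨γ, hγ⟩ := isConj_iff.mp h
  have := congrArg (fun δ : ProfiniteCompletion.completion (GrpCat.of (FreeGroup ι)) =>
    δ.1 (FiniteIndexNormalSubgroup.ofSubgroup K)) hγ
  exact isConj_iff.mpr ⟨γ.1 (FiniteIndexNormalSubgroup.ofSubgroup K), this⟩

/-- The same statement through the bundled morphism `η = ProfiniteCompletion.eta` (the form
`toCompletion F := (eta (GrpCat.of F)).hom` used in `Literature.IUT.HodgeTheaters`): images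
conjugate in `F̂` ⇒ conjugate in `F`. [cite: LyndonSchupp2001, Ch. I Prop. 4.8] -/
theorem _root_.FreeGroup.isConj_of_isConj_eta {ι : Type u} {u v : FreeGroup ι}
    (h : IsConj ((ProfiniteCompletion.eta (GrpCat.of (FreeGroup ι))).hom u)
      ((ProfiniteCompletion.eta (GrpCat.of (FreeGroup ι))).hom v)) : IsConj u v :=
  FreeGroup.isConj_of_isConj_profiniteCompletion h

/-- Contrapositive: non-conjugate elements of a free group stay non-conjugate in the profinite
completion. [cite: LyndonSchupp2001, Ch. I Prop. 4.8] -/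
theorem _root_.FreeGroup.not_isConj_eta_of_not_isConj {ι : Type u} {u v : FreeGroup ι}
    (h : ¬ IsConj u v) :
    ¬ IsConj ((ProfiniteCompletion.eta (GrpCat.of (FreeGroup ι))).hom u)
      ((ProfiniteCompletion.eta (GrpCat.of (FreeGroup ι))).hom v) :=
  fun h' => h (FreeGroup.isConj_of_isConj_eta h')

end Literature.GroupTheory.CombinatorialGroupTheory
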